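import Literature.ComputerArithmetic.JeannerodRump2018.OptimalBound
import Mathlib.Data.Nat.Prime.Basic

/-!
# Jeannerod–Rump Theorem 3.2 (radix 2) PROVED: `u/(1+u)` is attained by a product iff `2^p + 1` is not prime

HONEST FRAMING (venture CertifiedArithmetic / cell `pub-lowprec`): certified error envelopes and
provably optimal rounding/accumulation schemes for low-precision formats under stated cost models;
every table by two implementations; no hardware or vendor claims.

We DISCHARGE the named fact `theorem32_radix2` of `Summation.lean` ([JeannerodRump2018, Thm 3.2],
radix `β = 2`, unbounded exponent range): the optimal relative error bound `E₁(xy) ≤ u/(1+u)`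
for the floating-point product of two floats is ATTAINED — by some `x, y ∈ F` and some
round-to-nearest map — if and only if `2^p + 1` is not prime. Proof (the paper's argument made
explicit): a real `t ≠ 0` has relative distance exactly `u/(1+u)` to `F` only if
`|t| = (1+u)·2^k = (2^p+1)·2^(k-p)` (the binade start `2^k ∈ F` forces `|t| ≥ (1+u)2^k`, the
grid of spacing `2u·2^k` forces `|t| ≤ (1+u)2^k`); for `t = xy` with `x = M2^e`, `y = N2^f`,
`|M|, |N| < 2^p`, this gives `|M||N| = (2^p+1)·2^j` with `j ≥ 0` (parity), impossible for a prime
`2^p + 1 > |M|, |N|`; conversely a factorisation `2^p + 1 = a·b` with `2 ≤ a, b < 2^p` gives floats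
`a, b` whose product `2^p + 1` is the midpoint of the consecutive floats `2^p`, `2^p + 2`, at
relative distance `1/(2^p+1) = u/(1+u)` from `F` under every nearest map (one exists:
`exists_nearestU`). For the cell: `p ∈ {2, 4, 8, 16}` (E5M2/E2M1, E4M3/E2M3-free…, E4M3, bfloat16)
have `2^p + 1` prime (5, 17, 257, 65537) — self-products never attain `u/(1+u)` — while `p = 3,
11, 24` (E3M2, binary16, binary32) do (`9 = 3·3`, `2049 = 3·683`, `2^24+1 = 97·257·673`); cf.
the venture's `LowPrec/Attain*.lean` at the format level.
-/

namespace Literature.ComputerArithmetic.JeannerodRump2018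

variable {p : ℕ}

/-! ### The unbounded-exponent float set -/

/-- `F` is symmetric. [cite: JeannerodRump2018, §1] -/
theorem IsFloatU.neg {x : ℚ} (h : IsFloatU p x) : IsFloatU p (-x) := by
  obtain ⟨M, e, hM, rfl⟩ := h
  exact ⟨-M, e, by simpa using hM, by push_cast; ring⟩

/-- Integers of modulus `< 2^p` are floats. [cite: JeannerodRump2018, §1] -/
theorem isFloatU_int {M : ℤ} (hM : |M| < 2 ^ p) : IsFloatU p (M : ℚ) :=
  ⟨M, 0, hM, by simp⟩

/-- Powers of two are floats (`2^k = 2^(p-1)·2^(k+1-p)`). [cite: JeannerodRump2018, §1] -/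
theorem isFloatU_zpow (hp : 1 ≤ p) (k : ℤ) : IsFloatU p ((2 : ℚ) ^ k) := by
  refine ⟨2 ^ (p - 1), k + 1 - p, ?_, ?_⟩
  · rw [abs_of_nonneg (by positivity)]
    exact_mod_cast Nat.pow_lt_pow_right (by norm_num) (by omega : p - 1 < p)
  · have : ((2 ^ (p - 1) : ℤ) : ℚ) = (2 : ℚ) ^ (((p - 1 : ℕ) : ℤ)) := by
      rw [zpow_natCast]; push_cast; ring
    rw [this, ← zpow_add₀ (by norm_num : (2 : ℚ) ≠ 0)]
    congr 1; omega

/-- An integer multiple `n · 2^e` with `|n| < 2^p` is a float. [cite: JeannerodRump2018, §1] -/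
theorem isFloatU_int_mul_zpow {n : ℤ} (hn : |n| < 2 ^ p) (e : ℤ) :
    IsFloatU p ((n : ℚ) * (2 : ℚ) ^ e) := ⟨n, e, hn, rfl⟩

/-- A positive float above `2^k` is an integer multiple of the spacing `2^(k+1-p)` of that binade.
[cite: JeannerodRump2018, §2] -/
theorem exists_int_mul_of_lt {g : ℚ} (hg : IsFloatU p g) {k : ℤ} (hk : (2 : ℚ) ^ k < g) :
    ∃ n : ℤ, g = (n : ℚ) * (2 : ℚ) ^ (k + 1 - p) := by
  obtain ⟨M, e, hM, rfl⟩ := hg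
  have h2 : (0 : ℚ) < (2 : ℚ) ^ e := zpow_pos (by norm_num) _
  have hMpos : (0 : ℚ) < M := by
    by_contra h
    have : (M : ℚ) * 2 ^ e ≤ 0 := mul_nonpos_of_nonpos_of_nonneg (not_lt.mp h) h2.le
    linarith [zpow_pos (by norm_num : (0:ℚ) < 2) k]
  have hMlt : (M : ℚ) < 2 ^ p := by
    have : ((|M| : ℤ) : ℚ) < ((2 ^ p : ℤ) : ℚ) := by exact_mod_cast hM
    push_cast at this
    rw [abs_of_pos (by exact_mod_cast hMpos)] at this
    exact this
  -- 2^k < M 2^e < 2^(p+e) ⇒ k < p + e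
  have hke : k + 1 - p ≤ e := by
    by_contra hlt
    have hlt : e + p ≤ k := by omega
    have : (M : ℚ) * 2 ^ e < 2 ^ (e + (p : ℤ)) := by
      rw [zpow_add₀ (by norm_num), zpow_natCast]; nlinarith
    have h3 : (2 : ℚ) ^ (e + (p : ℤ)) ≤ 2 ^ k := zpow_le_zpow_right₀ (by norm_num) (by omega)
    linarith
  obtain ⟨d, hd⟩ := Int.eq_ofNat_of_zero_le (sub_nonneg.mpr hke)
  refine ⟨M * 2 ^ d, ?_⟩
  rw [show e = (k + 1 - p) + (d : ℤ) by omega, zpow_add₀ (by norm_num : (2 : ℚ) ≠ 0), zpow_natCast]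
  push_cast; ring

/-! ### The binade grid around a positive real and a nearest float -/

/-- For `t > 0` with `k = ⌊log₂ t⌋`, `c = 2^(k+1-p)`, `m = ⌊t/c⌋`: the grid points `m·c ≤ t < (m+1)·c`
and `2^k` are floats, `2^k ≤ m·c`, `(m+1)·c ≤ 2^(k+1)`, and every float is `≤ m·c` or
`≥ (m+1)·c`. [cite: JeannerodRump2018, §2] -/
theorem grid_facts (hp : 1 ≤ p) {t : ℚ} (ht : 0 < t) :
    let k := Int.log 2 t
    let c := (2 : ℚ) ^ (k + 1 - p)
    let m := ⌊t / c⌋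
    0 < c ∧ (m : ℚ) * c ≤ t ∧ t < ((m : ℚ) + 1) * c ∧ (2 : ℚ) ^ k ≤ (m : ℚ) * c ∧
      IsFloatU p ((m : ℚ) * c) ∧ IsFloatU p (((m : ℚ) + 1) * c) ∧
      (2 : ℚ) ^ k * (2 * unitRoundoff p) = c ∧
      ∀ g : ℚ, IsFloatU p g → g ≤ (m : ℚ) * c ∨ ((m : ℚ) + 1) * c ≤ g := by
  intro k c m
  have h2 : (2 : ℚ) ≠ 0 := by norm_num
  have hlow : ((2 : ℕ) : ℚ) ^ k ≤ t := Int.zpow_log_le_self (by norm_num) ht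
  have hup : t < ((2 : ℕ) : ℚ) ^ (k + 1) := Int.lt_zpow_succ_log_self (by norm_num) t
  push_cast at hlow hup
  have hcpos : 0 < c := zpow_pos (by norm_num) _
  have hg : (2 : ℚ) ^ k = (2 : ℚ) ^ ((p : ℤ) - 1) * c := by
    show (2 : ℚ) ^ k = (2 : ℚ) ^ ((p : ℤ) - 1) * (2 : ℚ) ^ (k + 1 - p)
    rw [← zpow_add₀ h2]; congr 1; ring
  have hg2 : (2 : ℚ) ^ (k + 1) = (2 : ℚ) ^ (p : ℤ) * c := by
    show (2 : ℚ) ^ (k + 1) = (2 : ℚ) ^ (p : ℤ) * (2 : ℚ) ^ (k + 1 - p)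
    rw [← zpow_add₀ h2]; congr 1; ring
  have hm_le : (m : ℚ) ≤ t / c := Int.floor_le _
  have hm_lt : t / c < m + 1 := Int.lt_floor_add_one _
  have hm_ge : (2 ^ (p - 1) : ℤ) ≤ m := by
    rw [Int.le_floor]; push_cast
    rw [le_div_iff₀ hcpos]
    have : ((2 : ℕ) : ℚ) ^ (p - 1) * c = (2 : ℚ) ^ k := by
      rw [hg, show ((p : ℤ) - 1) = ((p - 1 : ℕ) : ℤ) by omega, zpow_natCast]; push_cast; ring
    push_cast at this; linarith
  have hm_lt' : m < (2 ^ p : ℤ) := by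
    rw [Int.floor_lt]; push_cast
    rw [div_lt_iff₀ hcpos]
    have : ((2 : ℕ) : ℚ) ^ p * c = (2 : ℚ) ^ (k + 1) := by rw [hg2, zpow_natCast]; push_cast; ring
    push_cast at this; linarith
  have hm0 : (0 : ℤ) ≤ m := le_trans (by positivity) hm_ge
  have hf1le : (m : ℚ) * c ≤ t := by rwa [le_div_iff₀ hcpos] at hm_le
  have hf2gt : t < ((m : ℚ) + 1) * c := by rw [div_lt_iff₀ hcpos] at hm_lt; linarith
  have hkf1 : (2 : ℚ) ^ k ≤ (m : ℚ) * c := by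
    have : ((2 ^ (p - 1) : ℤ) : ℚ) ≤ m := by exact_mod_cast hm_ge
    rw [hg, show ((p : ℤ) - 1) = ((p - 1 : ℕ) : ℤ) by omega, zpow_natCast]
    push_cast at this
    exact mul_le_mul_of_nonneg_right this hcpos.le
  have hf1 : IsFloatU p ((m : ℚ) * c) := ⟨m, k + 1 - p, by rw [abs_of_nonneg hm0]; exact hm_lt', rfl⟩
  have hf2 : IsFloatU p (((m : ℚ) + 1) * c) := by
    rcases lt_or_eq_of_le (Int.add_one_le_iff.mpr hm_lt') with hlt | heq
    · refine ⟨m + 1, k + 1 - p, ?_, by push_cast; ring⟩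
      rw [abs_of_nonneg (by linarith)]; exact hlt
    · have : ((m : ℚ) + 1) * c = (2 : ℚ) ^ (k + 1) := by
        have hm1 : ((m + 1 : ℤ) : ℚ) = ((2 ^ p : ℤ) : ℚ) := by rw [heq]
        push_cast at hm1
        rw [hm1, hg2, zpow_natCast]
      rw [this]; exact isFloatU_zpow hp (k + 1)
  have hu : (2 : ℚ) ^ k * (2 * unitRoundoff p) = c := by
    unfold unitRoundoff
    show (2 : ℚ) ^ k * (2 * (1 / 2 ^ p)) = (2 : ℚ) ^ (k + 1 - p)
    rw [show (k + 1 - (p : ℤ)) = k + 1 + (-(p : ℤ)) by ring, zpow_add₀ h2, zpow_add₀ h2,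
      zpow_neg, zpow_natCast, zpow_one]
    field_simp
  refine ⟨hcpos, hf1le, hf2gt, hkf1, hf1, hf2, hu, fun g hgF => ?_⟩
  by_cases hgk : g ≤ (2 : ℚ) ^ k
  · left; linarith
  · obtain ⟨n, hn⟩ := exists_int_mul_of_lt hgF (not_le.mp hgk)
    -- g = n c: an integer multiple of c is ≤ m c or ≥ (m+1) c
    rcases le_or_gt n m with hnm | hnm
    · left; rw [hn]
      exact mul_le_mul_of_nonneg_right (by exact_mod_cast hnm) hcpos.le
    · right; rw [hn]
      have : (m : ℚ) + 1 ≤ n := by exact_mod_cast hnm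
      exact mul_le_mul_of_nonneg_right this hcpos.le

/-- A nearest float exists for every real (unbounded exponent range, precision `p ≥ 1`); hence a
round-to-nearest map `fl` exists. [cite: JeannerodRump2018, §1 eq. (1.1)] -/
theorem exists_nearestU (hp : 1 ≤ p) (t : ℚ) :
    ∃ f : ℚ, IsFloatU p f ∧ ∀ g : ℚ, IsFloatU p g → |t - f| ≤ |t - g| := by
  -- positive case
  have pos : ∀ s : ℚ, 0 < s → ∃ f : ℚ, IsFloatU p f ∧ ∀ g : ℚ, IsFloatU p g → |s - f| ≤ |s - g| := by
    intro s hs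
    obtain ⟨hcpos, hf1le, hf2gt, -, hf1, hf2, -, hgrid⟩ := grid_facts (p := p) hp hs
    set k := Int.log 2 s
    set c := (2 : ℚ) ^ (k + 1 - p)
    set m := ⌊s / c⌋
    by_cases hnear : s - (m : ℚ) * c ≤ ((m : ℚ) + 1) * c - s
    · refine ⟨(m : ℚ) * c, hf1, fun g hg => ?_⟩
      rw [abs_of_nonneg (by linarith)]
      rcases hgrid g hg with h | h
      · rw [abs_of_nonneg (by linarith)]; linarith
      · rw [abs_of_nonpos (by linarith)]; linarith
    · refine ⟨((m : ℚ) + 1) * c, hf2, fun g hg => ?_⟩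
      rw [abs_of_nonpos (by linarith)]
      rcases hgrid g hg with h | h
      · rw [abs_of_nonneg (by linarith)]; linarith
      · rw [abs_of_nonpos (by linarith)]; linarith
  rcases lt_trichotomy t 0 with hneg | hzero | hpos
  · obtain ⟨f, hf, hmin⟩ := pos (-t) (by linarith)
    refine ⟨-f, hf.neg, fun g hg => ?_⟩
    have := hmin (-g) hg.neg
    rw [show |t - -f| = |-t - f| by rw [← abs_neg]; ring_nf,
      show |t - g| = |-t - -g| by rw [← abs_neg]; ring_nf]
    exact this
  · subst hzero
    exact ⟨0, ⟨0, 0, by simp, by simp⟩, fun g _ => by simp⟩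
  · exact pos t hpos

/-! ### Only `(1+u)·2^k` is at relative distance `u/(1+u)` from `F` -/

/-- If a nearest rounding of `t > 0` errs by exactly `u/(1+u)·t`, then `t = (1+u)·2^⌊log₂ t⌋`.
[cite: JeannerodRump2018, Thm 3.2 (proof)] -/
theorem eq_of_sharp_pos (hp : 1 ≤ p) {fl : ℚ → ℚ} (hfl : IsRoundNearestU p fl) {t : ℚ}
    (ht : 0 < t) (heq : |t - fl t| = unitRoundoff p / (1 + unitRoundoff p) * t) :
    t = (1 + unitRoundoff p) * (2 : ℚ) ^ (Int.log 2 t) := by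
  obtain ⟨hcpos, hf1le, hf2gt, hkf1, hf1, hf2, hu, -⟩ := grid_facts (p := p) hp ht
  set k := Int.log 2 t
  set c := (2 : ℚ) ^ (k + 1 - p)
  set m := ⌊t / c⌋
  have hupos : 0 < unitRoundoff p := by unfold unitRoundoff; positivity
  -- candidate 2^k: error ≤ t - 2^k
  have e0 := (hfl t).2 _ (isFloatU_zpow hp k)
  have hlow : (2 : ℚ) ^ k ≤ t := le_trans hkf1 hf1le
  rw [abs_of_nonneg (by linarith : 0 ≤ t - 2 ^ k)] at e0
  -- candidates m c, (m+1) c: error ≤ c/2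
  have e1 := (hfl t).2 _ hf1
  have e2 := (hfl t).2 _ hf2
  rw [abs_of_nonneg (by linarith : 0 ≤ t - m * c)] at e1
  rw [abs_of_nonpos (by linarith : t - ((m : ℚ) + 1) * c ≤ 0)] at e2
  have eh : |t - fl t| ≤ c / 2 := by
    rcases le_total (t - m * c) (c / 2) with h | h
    · exact le_trans e1 h
    · linarith
  rw [heq] at e0 eh
  -- u t/(1+u) ≤ t - 2^k and ≤ c/2 = u 2^k  ⇒  t = (1+u) 2^k
  have h1 : unitRoundoff p / (1 + unitRoundoff p) * t * (1 + unitRoundoff p) = unitRoundoff p * t := by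
    field_simp
  have hA : (1 + unitRoundoff p) * 2 ^ k ≤ t := by
    have := mul_le_mul_of_nonneg_right e0 (by linarith : (0:ℚ) ≤ 1 + unitRoundoff p)
    nlinarith
  have hB : t ≤ (1 + unitRoundoff p) * 2 ^ k := by
    have := mul_le_mul_of_nonneg_right eh (by linarith : (0:ℚ) ≤ 1 + unitRoundoff p)
    rw [h1] at this
    rw [← hu] at this
    nlinarith [zpow_pos (by norm_num : (0:ℚ) < 2) k]
  exact le_antisymm hB hA

/-! ### Theorem 3.2, radix 2 -/

/-- `2^p + 1` is odd (`p ≥ 1`). [cite: JeannerodRump2018, Thm 3.2] -/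
theorem two_pow_succ_odd (hp : 1 ≤ p) : ¬ 2 ∣ 2 ^ p + 1 := by
  intro h
  have : 2 ∣ 2 ^ p := dvd_pow_self 2 (by omega)
  omega

/-- ONLY IF: if some nearest rounding of a product `xy` of floats errs by exactly `u/(1+u)|xy|`,
then `2^p + 1` is composite. [cite: JeannerodRump2018, Thm 3.2] -/
theorem not_prime_of_attained (hp : 1 ≤ p) {fl : ℚ → ℚ} (hfl : IsRoundNearestU p fl) {x y : ℚ}
    (hx : IsFloatU p x) (hy : IsFloatU p y) (hxy : x * y ≠ 0)
    (heq : |x * y - fl (x * y)| = unitRoundoff p / (1 + unitRoundoff p) * |x * y|) :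
    ¬ Nat.Prime (2 ^ p + 1) := by
  -- reduce to t = |x y| > 0 with a nearest map (mirror if negative)
  have key : ∃ k : ℤ, |x * y| = (1 + unitRoundoff p) * 2 ^ k := by
    rcases lt_or_gt_of_ne hxy with hneg | hpos
    · -- mirrored map
      have hfl' : IsRoundNearestU p (fun t => -fl (-t)) := by
        intro t
        refine ⟨(hfl (-t)).1.neg, fun f hf => ?_⟩
        have h := (hfl (-t)).2 (-f) hf.neg
        rw [show |t - -fl (-t)| = |-t - fl (-t)| by rw [← abs_neg]; ring_nf]
        rwa [show |(-t) - (-f)| = |t - f| by rw [← abs_neg]; ring_nf] at h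
      refine ⟨Int.log 2 (-(x * y)), ?_⟩
      have h := eq_of_sharp_pos hp hfl' (t := -(x * y)) (by linarith) (by
        simp only [neg_neg]
        rw [abs_of_neg hneg] at heq
        rw [show |-(x * y) - -fl (x * y)| = |x * y - fl (x * y)| by rw [← abs_neg]; ring_nf, heq])
      rw [abs_of_neg hneg]; exact h
    · refine ⟨Int.log 2 (x * y), ?_⟩
      have h := eq_of_sharp_pos hp hfl hpos (by rw [abs_of_pos hpos] at heq; exact heq)
      rw [abs_of_pos hpos]; exact h
  obtain ⟨k, hk⟩ := key
  obtain ⟨M, e, hM, rfl⟩ := hx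
  obtain ⟨N, f, hN, rfl⟩ := hy
  -- |M| |N| 2^(e+f) = (2^p + 1) 2^(k-p)
  have h2 : (2 : ℚ) ≠ 0 := by norm_num
  have hprod : (M.natAbs : ℚ) * (N.natAbs : ℚ) = (2 ^ p + 1 : ℚ) * 2 ^ (k - p - e - f) := by
    have two_pos' : (0 : ℚ) < 2 := by norm_num
    have habs : |((M : ℚ) * 2 ^ e) * ((N : ℚ) * 2 ^ f)| = |(M : ℚ)| * |(N : ℚ)| * 2 ^ (e + f) := by
      have e1 : |((M : ℚ) * 2 ^ e) * ((N : ℚ) * 2 ^ f)| = |(M : ℚ)| * 2 ^ e * (|(N : ℚ)| * 2 ^ f) := by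
        rw [abs_mul, abs_mul, abs_mul, abs_of_pos (zpow_pos two_pos' e), abs_of_pos (zpow_pos two_pos' f)]
      rw [e1, zpow_add₀ h2]; ring
    have hcast : (M.natAbs : ℚ) * (N.natAbs : ℚ) = |(M : ℚ)| * |(N : ℚ)| := by
      rw [Nat.cast_natAbs, Nat.cast_natAbs, Int.cast_abs, Int.cast_abs]
    have hu : (1 + unitRoundoff p) = (2 ^ p + 1 : ℚ) * 2 ^ (-(p : ℤ)) := by
      unfold unitRoundoff; rw [zpow_neg, zpow_natCast]; field_simp
    rw [habs, hu] at hk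
    have hef : (0 : ℚ) < 2 ^ (e + f) := zpow_pos two_pos' _
    have h3 : |(M : ℚ)| * |(N : ℚ)| = (2 ^ p + 1 : ℚ) * 2 ^ (-(p : ℤ)) * 2 ^ k / 2 ^ (e + f) := by
      rw [eq_div_iff hef.ne']; exact hk
    rw [hcast, h3, div_eq_mul_inv, ← zpow_neg,
      show k - (p : ℤ) - e - f = -(p : ℤ) + k + (-(e + f)) by ring, zpow_add₀ h2, zpow_add₀ h2]
    ring
  -- the exponent j = k - p - e - f is ≥ 0 by parity, so (2^p+1) ∣ |M| |N|
  set j := k - p - e - f with hj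
  have hdvd : (2 ^ p + 1) ∣ M.natAbs * N.natAbs := by
    rcases le_or_gt 0 j with hj0 | hj0
    · obtain ⟨d, hd⟩ := Int.eq_ofNat_of_zero_le hj0
      refine ⟨2 ^ d, ?_⟩
      have : ((M.natAbs * N.natAbs : ℕ) : ℚ) = (((2 ^ p + 1) * 2 ^ d : ℕ) : ℚ) := by
        push_cast
        rw [hprod, hd, zpow_natCast]
      exact_mod_cast this
    · exfalso
      obtain ⟨d, hd⟩ := Int.eq_ofNat_of_zero_le (by omega : 0 ≤ -j)
      have hd1 : 1 ≤ d := by omega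
      have : ((M.natAbs * N.natAbs * 2 ^ d : ℕ) : ℚ) = ((2 ^ p + 1 : ℕ) : ℚ) := by
        push_cast
        rw [hprod, show (2 : ℚ) ^ d = 2 ^ (-j) by rw [hd, zpow_natCast], mul_assoc, ← zpow_add₀ h2]
        simp
      have hnat : M.natAbs * N.natAbs * 2 ^ d = 2 ^ p + 1 := by exact_mod_cast this
      apply two_pow_succ_odd hp
      rw [← hnat]
      exact Dvd.dvd.mul_left (dvd_pow_self 2 (by omega)) _
  intro hprime
  have hM0 : M ≠ 0 := by rintro rfl; simp at hxy
  have hN0 : N ≠ 0 := by rintro rfl; simp at hxy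
  have hMlt : M.natAbs < 2 ^ p := by
    have : (M.natAbs : ℤ) < 2 ^ p := by rw [Int.natCast_natAbs]; exact hM
    exact_mod_cast this
  have hNlt : N.natAbs < 2 ^ p := by
    have : (N.natAbs : ℤ) < 2 ^ p := by rw [Int.natCast_natAbs]; exact hN
    exact_mod_cast this
  rcases (Nat.Prime.dvd_mul hprime).mp hdvd with h | h
  · have := Nat.le_of_dvd (Int.natAbs_pos.mpr hM0) h; omega
  · have := Nat.le_of_dvd (Int.natAbs_pos.mpr hN0) h; omega

/-- IF: a factorisation `2^p + 1 = a·b` (`2 ≤ a, b < 2^p`) gives floats `a`, `b` whose product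
`2^p + 1` is at distance exactly `1 = u/(1+u)·(2^p+1)` from `F` (midpoint of `2^p` and `2^p + 2`),
under every nearest map. [cite: JeannerodRump2018, Thm 3.2] -/
theorem attained_of_not_prime (hp : 2 ≤ p) (hnp : ¬ Nat.Prime (2 ^ p + 1)) :
    ∃ (fl : ℚ → ℚ) (x y : ℚ), IsRoundNearestU p fl ∧ IsFloatU p x ∧ IsFloatU p y ∧ x * y ≠ 0 ∧
      |x * y - fl (x * y)| = unitRoundoff p / (1 + unitRoundoff p) * |x * y| := by
  have hp1 : 1 ≤ p := le_trans (by norm_num) hp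
  obtain ⟨a, hadvd, ha2, halt⟩ := Nat.exists_dvd_of_not_prime2 (by
    have := Nat.one_le_two_pow (n := p); omega) hnp
  obtain ⟨b, hab⟩ := hadvd
  have hpow : 2 ^ p + 1 = a * b := hab
  have hb0 : b ≠ 0 := by rintro rfl; simp at hpow
  have hb1 : b ≠ 1 := by rintro rfl; rw [mul_one] at hpow; omega
  have hb2 : 2 ≤ b := by omega
  have halt' : a < 2 ^ p := by nlinarith
  have hblt' : b < 2 ^ p := by nlinarith
  -- a nearest map
  choose fl hflF hflmin using exists_nearestU (p := p) hp1
  have hfl : IsRoundNearestU p fl := fun t => ⟨hflF t, hflmin t⟩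
  refine ⟨fl, a, b, hfl, isFloatU_int (M := a) (by rw [abs_of_nonneg (by positivity)]; exact_mod_cast halt'),
    isFloatU_int (M := b) (by rw [abs_of_nonneg (by positivity)]; exact_mod_cast hblt'), ?_, ?_⟩
  · have : (0 : ℚ) < a * b := by positivity
    exact_mod_cast this.ne'
  · -- the product is T = 2^p + 1, and |T - fl T| = 1
    have hT : (a : ℚ) * b = 2 ^ p + 1 := by exact_mod_cast hpow.symm
    have hTpos : (0 : ℚ) < 2 ^ p + 1 := by positivity
    rw [hT, abs_of_pos hTpos]
    have hu : unitRoundoff p / (1 + unitRoundoff p) * (2 ^ p + 1 : ℚ) = 1 := by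
      unfold unitRoundoff; field_simp
    rw [hu]
    apply le_antisymm
    · -- candidate 2^p
      have := hflmin (2 ^ p + 1 : ℚ) _ (isFloatU_zpow hp1 (p : ℤ))
      rw [zpow_natCast, show (2 ^ p + 1 : ℚ) - 2 ^ p = 1 by ring, abs_one] at this
      exact this
    · -- every float is at distance ≥ 1 from the odd integer 2^p + 1
      have hgF := hflF (2 ^ p + 1 : ℚ)
      -- in this binade c = 2 and m = 2^(p-1)·… : use the multiple-of-2 structure directly
      by_cases hle : fl (2 ^ p + 1 : ℚ) ≤ 2 ^ p
      · rw [abs_of_nonneg (by linarith)]; linarith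
      · obtain ⟨n, hn⟩ := exists_int_mul_of_lt hgF (k := p) (by rw [zpow_natCast]; exact not_le.mp hle)
        rw [show ((p : ℤ) + 1 - p) = 1 by ring, zpow_one] at hn
        -- |2^p + 1 - 2n| ≥ 1 for integers
        rw [hn]
        have hint : (2 ^ p + 1 : ℚ) - (n : ℚ) * 2 = (((2 ^ p + 1 - n * 2 : ℤ)) : ℚ) := by push_cast; ring
        rw [hint]
        have hne : (2 ^ p + 1 - n * 2 : ℤ) ≠ 0 := by
          intro h0
          have : (2 : ℤ) ∣ 2 ^ p + 1 := ⟨n, by linarith⟩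
          have h2 : (2 : ℤ) ∣ 2 ^ p := dvd_pow_self 2 (by omega)
          omega
        have := Int.one_le_abs hne
        exact_mod_cast this

/-- THEOREM 3.2 (radix 2) DISCHARGED: the bound `E₁(xy) ≤ u/(1+u)` for floating-point products is
attained iff `2^p + 1` is not prime. [cite: JeannerodRump2018, Thm 3.2] -/
theorem theorem32_radix2_holds : theorem32_radix2 := by
  intro p hp
  constructor
  · rintro ⟨fl, x, y, hfl, hx, hy, hxy, heq⟩
    exact not_prime_of_attained (le_trans (by norm_num) hp) hfl hx hy hxy heq
  · exact attained_of_not_prime hp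

end Literature.ComputerArithmetic.JeannerodRump2018
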